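import Literature.Topology.FourManifolds.CoreParams
import Literature.Topology.FourManifolds.MonotoneInverse
import HarnessLib

/-!
# Gluing the parameters of two band-sum data along their necks: the junction clock

Topic `Literature/Topology/FourManifolds` (trunk T-4MAN). Fact seat
`provefact-Literature.Topology.FourManifolds.Knot.IsConnectedSum.isIsotopic` (Schubert's theorem),
geometric heart for rail knots. A hybrid frame is parametrised by the circle of a first datum `b₁`
and carries, on its foreign parameter zone `[parHi₁ (-1), parLo₁ (-1) + 1]` (from the upper core
of `b₁` across the seam to its lower core), material of a second datum `b₂` living on `b₂`'s
southern parameters `[parLo₂ 1, parHi₂ 1]`. The two parametrisations are glued by a **junction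
clock** `ϑ` with `αLo₂ (ϑ t) = -αHi₁ t` near the first junction and `αHi₂ (ϑ t) = -αLo₁ (t - 1)`
near the second (so that coincident flat necks get coincident parameters), smooth and strictly
increasing in between. This file constructs `ϑ` (`exists_junctionClock`, `junctionClock`):

* the level-to-parameter maps of `b₂` as functions (`invFunOn` of `αLo₂`, `αHi₂` on the closed
  cores; `MonotoneInverse.lean`): equal to `parLo₂`, `parHi₂`, smooth with derivative of the
  right sign at interior levels;
* the two germs `t ↦ parLo₂ (-αHi₁ t)`, `t ↦ parHi₂ (-αLo₁ (t - 1))` globalised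
  (`exists_increasing_extension_left/right`) and blended with an affine middle piece
  (`exists_blend_deriv_pos`), exactly as the tip clock of `DeepArcPlanar.lean`.

Everything is proved; no named facts are introduced.

## References

Standard one-variable analysis; all statements `[folklore]`.
-/

open scoped Manifold ContDiff Topology Real
open Function Set Metric Filter

noncomputable section

namespace Literature.Topology.FourManifolds

/-- Local notation: `𝕊 n` is the unit sphere in `EuclideanSpace ℝ (Fin (n + 1))`. -/
local notation "𝕊 " n:arg => (Metric.sphere (0 : EuclideanSpace ℝ (Fin (n + 1))) 1)

namespace BandData

variable {A₁ B₁ K₁ : Knot} {av₁ : Set (𝕊 3)} (b₁ : BandData A₁ B₁ K₁ av₁)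
  {A₂ B₂ K₂ : Knot} {av₂ : Set (𝕊 3)} (b₂ : BandData A₂ B₂ K₂ av₂)
  {κ : ℝ} (hκ : 0 < κ)

/-! ### The level-to-parameter maps as smooth functions -/

/-- **The lower level map**: the inverse of `αLo` on the closed lower core. [folklore] -/
def levLo (b : BandData A₂ B₂ K₂ av₂) (κ : ℝ) : ℝ → ℝ :=
  invFunOn (b.alphaLo κ) (Icc (b.tcLo - b.epsLo / 8) (b.tcLo + b.epsLo / 8))

/-- **The upper level map**: the inverse of `αHi` on the closed upper core. [folklore] -/
def levHi (b : BandData A₂ B₂ K₂ av₂) (κ : ℝ) : ℝ → ℝ :=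
  invFunOn (b.alphaHi κ) (Icc (b.tcHi - b.epsHi / 8) (b.tcHi + b.epsHi / 8))

section LevelMaps

variable (b : BandData A₂ B₂ K₂ av₂)
include hκ

/-- The lower level map at a level in `[-7, 7]` is `parLo`. [folklore] -/
theorem levLo_eq_parLo (h7 : 7 * κ ≤ b.gapLo) {v : ℝ} (hv : v ∈ Icc (-7 : ℝ) 7) : levLo b κ v = b.parLo hκ h7 hv := by
  have hε := b.epsLo_bounds.1
  obtain ⟨h1, -, -⟩ := MonoInverse (Θ := b.alphaLo κ) (u₀ := b.tcLo - b.epsLo / 8) (u₁ := b.tcLo + b.epsLo / 8) (by linarith)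
    (b.contDiff_alphaLo κ).continuous.continuousOn (b.strictMonoOn_alphaLo hκ)
  have := h1 _ (b.parLo_mem_core hκ h7 hv)
  rwa [b.alphaLo_parLo hκ h7 hv] at this

/-- The upper level map at a level in `[-7, 7]` is `parHi`. [folklore] -/
theorem levHi_eq_parHi (h7' : 7 * κ ≤ b.gapHi) {v : ℝ} (hv : v ∈ Icc (-7 : ℝ) 7) : levHi b κ v = b.parHi hκ h7' hv := by
  have hε := b.epsHi_bounds.1
  obtain ⟨h1, -, -⟩ := AntiInverse (Θ := b.alphaHi κ) (u₀ := b.tcHi - b.epsHi / 8) (u₁ := b.tcHi + b.epsHi / 8) (by linarith)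
    (b.contDiff_alphaHi κ).continuous.continuousOn (b.strictAntiOn_alphaHi hκ)
  have := h1 _ (b.parHi_mem_core hκ h7' hv)
  rwa [b.alphaHi_parHi hκ h7' hv] at this

/-- **The lower level map is smooth with positive derivative** at levels in `(-7, 7)`. [folklore] -/
theorem contDiffAt_levLo (h7 : 7 * κ ≤ b.gapLo) {v : ℝ} (hv : v ∈ Ioo (-7 : ℝ) 7) :
    ContDiffAt ℝ ∞ (levLo b κ) v ∧ 0 < deriv (levLo b κ) v := by
  have hε := b.epsLo_bounds.1
  have hv' : v ∈ Icc (-7 : ℝ) 7 := Ioo_subset_Icc_self hv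
  have hsm := MonoInverse_smooth (Θ := b.alphaLo κ) (u₀ := b.tcLo - b.epsLo / 8) (u₁ := b.tcLo + b.epsLo / 8) (by linarith)
    (b.contDiff_alphaLo κ).continuous.continuousOn (b.strictMonoOn_alphaLo hκ)
    (fun u _ ↦ (b.contDiff_alphaLo κ).contDiffAt)
    (fun u hu ↦ by rw [(b.hasDerivAt_alphaLo κ u).deriv]; exact div_pos (b.deriv_chiLo_pos (Ioo_subset_Icc_self hu)) hκ)
  have hmem := b.parLo_mem_openCore hκ h7 hv' hv
  obtain ⟨hs, hd⟩ := hsm _ hmem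
  rw [b.alphaLo_parLo hκ h7 hv'] at hs hd
  refine ⟨hs, ?_⟩
  show 0 < deriv (invFunOn (b.alphaLo κ) (Icc (b.tcLo - b.epsLo / 8) (b.tcLo + b.epsLo / 8))) v
  rw [hd, (b.hasDerivAt_alphaLo κ _).deriv]
  exact inv_pos.2 (div_pos (b.deriv_chiLo_pos (Ioo_subset_Icc_self hmem)) hκ)

/-- **The upper level map is smooth with negative derivative** at levels in `(-7, 7)`. [folklore] -/
theorem contDiffAt_levHi (h7' : 7 * κ ≤ b.gapHi) {v : ℝ} (hv : v ∈ Ioo (-7 : ℝ) 7) :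
    ContDiffAt ℝ ∞ (levHi b κ) v ∧ deriv (levHi b κ) v < 0 := by
  have hε := b.epsHi_bounds.1
  have hv' : v ∈ Icc (-7 : ℝ) 7 := Ioo_subset_Icc_self hv
  have hsm := AntiInverse_smooth (Θ := b.alphaHi κ) (u₀ := b.tcHi - b.epsHi / 8) (u₁ := b.tcHi + b.epsHi / 8) (by linarith)
    (b.contDiff_alphaHi κ).continuous.continuousOn (b.strictAntiOn_alphaHi hκ)
    (fun u _ ↦ (b.contDiff_alphaHi κ).contDiffAt)
    (fun u hu ↦ by rw [(b.hasDerivAt_alphaHi κ u).deriv]; exact div_neg_of_neg_of_pos (b.deriv_chiHi_neg (Ioo_subset_Icc_self hu)) hκ)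
  have hmem := b.parHi_mem_openCore hκ h7' hv' hv
  obtain ⟨hs, hd⟩ := hsm _ hmem
  rw [b.alphaHi_parHi hκ h7' hv'] at hs hd
  refine ⟨hs, ?_⟩
  show deriv (invFunOn (b.alphaHi κ) (Icc (b.tcHi - b.epsHi / 8) (b.tcHi + b.epsHi / 8))) v < 0
  rw [hd, (b.hasDerivAt_alphaHi κ _).deriv]
  exact inv_lt_zero.2 (div_neg_of_neg_of_pos (b.deriv_chiHi_neg (Ioo_subset_Icc_self hmem)) hκ)

end LevelMaps

/-! ### Levels -/

omit b₁ b₂ in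
/-- `-1/2 ∈ [-7, 7]`. [folklore] -/
theorem neg_half_mem : (-(1 / 2) : ℝ) ∈ Icc (-7 : ℝ) 7 := ⟨by norm_num, by norm_num⟩

omit b₁ b₂ in
/-- `-1/4 ∈ [-7, 7]`. [folklore] -/
theorem neg_quarter_mem : (-(1 / 4) : ℝ) ∈ Icc (-7 : ℝ) 7 := ⟨by norm_num, by norm_num⟩

omit b₁ b₂ in
/-- `-5 ∈ [-7, 7]`. [folklore] -/
theorem neg_five_mem : (-5 : ℝ) ∈ Icc (-7 : ℝ) 7 := ⟨by norm_num, by norm_num⟩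

omit b₁ b₂ in
/-- `-21/4 ∈ [-7, 7]`. [folklore] -/
theorem neg_twentyone_mem : (-(21 / 4) : ℝ) ∈ Icc (-7 : ℝ) 7 := ⟨by norm_num, by norm_num⟩

omit b₁ b₂ in
/-- `-11/2 ∈ [-7, 7]`. [folklore] -/
theorem neg_eleven_halves_mem : (-(11 / 2) : ℝ) ∈ Icc (-7 : ℝ) 7 := ⟨by norm_num, by norm_num⟩

omit b₁ b₂ in
/-- `1/2 ∈ [-7, 7]`. [folklore] -/
theorem half_mem : (1 / 2 : ℝ) ∈ Icc (-7 : ℝ) 7 := ⟨by norm_num, by norm_num⟩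

/-! ### The junction clock -/

section Junction

variable (h7₁ : 7 * κ ≤ b₁.gapLo) (h7₁' : 7 * κ ≤ b₁.gapHi) (h7₂ : 7 * κ ≤ b₂.gapLo) (h7₂' : 7 * κ ≤ b₂.gapHi)
include hκ h7₁ h7₁' h7₂ h7₂'

set_option maxHeartbeats 800000 in
/-- **Existence of the junction clock** between the parameters of `b₁` and `b₂`. [folklore] -/
theorem exists_junctionClock :
    ∃ ϑ : ℝ → ℝ, ContDiff ℝ ∞ ϑ ∧
      (∀ t ∈ Icc (b₁.parHi hκ h7₁' neg_half_mem) (b₁.parHi hκ h7₁' neg_five_mem),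
        ϑ t ∈ Icc (b₂.tcLo - b₂.epsLo / 8) (b₂.tcLo + b₂.epsLo / 8) ∧ b₂.alphaLo κ (ϑ t) = -b₁.alphaHi κ t) ∧
      (∀ t ∈ Icc (b₁.parLo hκ h7₁ neg_five_mem + 1) (b₁.parLo hκ h7₁ neg_half_mem + 1),
        ϑ t ∈ Icc (b₂.tcHi - b₂.epsHi / 8) (b₂.tcHi + b₂.epsHi / 8) ∧ b₂.alphaHi κ (ϑ t) = -b₁.alphaLo κ (t - 1)) ∧
      ∀ t ∈ Icc (b₁.parHi hκ h7₁' neg_half_mem) (b₁.parLo hκ h7₁ neg_half_mem + 1), 0 < deriv ϑ t := by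
  -- marks on the circle of `b₁`
  set u₀ := b₁.parHi hκ h7₁' neg_quarter_mem with hu₀
  set u₁ := b₁.parHi hκ h7₁' neg_half_mem with hu₁
  set u₅ := b₁.parHi hκ h7₁' neg_five_mem with hu₅
  set u₆ := b₁.parHi hκ h7₁' neg_twentyone_mem with hu₆
  set u₇ := b₁.parHi hκ h7₁' neg_eleven_halves_mem with hu₇
  set w₇ := b₁.parLo hκ h7₁ neg_eleven_halves_mem + 1 with hw₇
  set w₆ := b₁.parLo hκ h7₁ neg_twentyone_mem + 1 with hw₆
  set w₅ := b₁.parLo hκ h7₁ neg_five_mem + 1 with hw₅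
  set w₁ := b₁.parLo hκ h7₁ neg_half_mem + 1 with hw₁
  set w₀ := b₁.parLo hκ h7₁ neg_quarter_mem + 1 with hw₀
  have o01 : u₀ < u₁ := b₁.parHi_lt_parHi hκ h7₁' neg_half_mem neg_quarter_mem (by norm_num)
  have o15 : u₁ < u₅ := b₁.parHi_lt_parHi hκ h7₁' neg_five_mem neg_half_mem (by norm_num)
  have o56 : u₅ < u₆ := b₁.parHi_lt_parHi hκ h7₁' neg_twentyone_mem neg_five_mem (by norm_num)
  have o67 : u₆ < u₇ := b₁.parHi_lt_parHi hκ h7₁' neg_eleven_halves_mem neg_twentyone_mem (by norm_num)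
  have o7w : u₇ < w₇ := by
    have h1 := (b₁.parHi_mem_core hκ h7₁' neg_eleven_halves_mem).2
    have h2 := (b₁.parLo_mem_core hκ h7₁ neg_eleven_halves_mem).1
    have := b₁.core_marks; rw [hu₇, hw₇]; linarith
  have ow76 : w₇ < w₆ := by rw [hw₇, hw₆]; linarith [b₁.parLo_lt_parLo hκ h7₁ neg_eleven_halves_mem neg_twentyone_mem (by norm_num)]
  have ow65 : w₆ < w₅ := by rw [hw₆, hw₅]; linarith [b₁.parLo_lt_parLo hκ h7₁ neg_twentyone_mem neg_five_mem (by norm_num)]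
  have ow51 : w₅ < w₁ := by rw [hw₅, hw₁]; linarith [b₁.parLo_lt_parLo hκ h7₁ neg_five_mem neg_half_mem (by norm_num)]
  have ow10 : w₁ < w₀ := by rw [hw₁, hw₀]; linarith [b₁.parLo_lt_parLo hκ h7₁ neg_half_mem neg_quarter_mem (by norm_num)]
  have hcoreHi : ∀ {t}, t ∈ Icc u₀ u₇ → t ∈ Icc (b₁.tcHi - b₁.epsHi / 8) (b₁.tcHi + b₁.epsHi / 8) := fun {t} ht ↦
    ⟨le_trans (b₁.parHi_mem_core hκ h7₁' neg_quarter_mem).1 ht.1, le_trans ht.2 (b₁.parHi_mem_core hκ h7₁' neg_eleven_halves_mem).2⟩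
  have hcoreLo : ∀ {t}, t ∈ Icc w₇ w₀ → t - 1 ∈ Icc (b₁.tcLo - b₁.epsLo / 8) (b₁.tcLo + b₁.epsLo / 8) := fun {t} ht ↦
    ⟨by have := (b₁.parLo_mem_core hκ h7₁ neg_eleven_halves_mem).1; rw [hw₇] at ht; linarith [ht.1],
      by have := (b₁.parLo_mem_core hκ h7₁ neg_quarter_mem).2; rw [hw₀] at ht; linarith [ht.2]⟩
  -- levels along the zones
  have levHiZone : ∀ {t}, t ∈ Ioo u₀ u₇ → -b₁.alphaHi κ t ∈ Ioo (1 / 4 : ℝ) (11 / 2) := fun {t} ht ↦ by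
    have hc := hcoreHi (Ioo_subset_Icc_self ht)
    constructor
    · have := (b₁.alphaHi_lt_iff' hκ h7₁' neg_quarter_mem hc).2 ht.1; linarith
    · have := (b₁.lt_alphaHi_iff' hκ h7₁' neg_eleven_halves_mem hc).2 ht.2; linarith
  have levLoZone : ∀ {t}, t ∈ Ioo w₇ w₀ → -b₁.alphaLo κ (t - 1) ∈ Ioo (1 / 4 : ℝ) (11 / 2) := fun {t} ht ↦ by
    have hc := hcoreLo (Ioo_subset_Icc_self ht)
    constructor
    · have := (b₁.alphaLo_lt_iff' hκ h7₁ neg_quarter_mem hc).2 (by rw [hw₀] at ht; linarith [ht.2]); linarith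
    · have := (b₁.lt_alphaLo_iff' hκ h7₁ neg_eleven_halves_mem hc).2 (by rw [hw₇] at ht; linarith [ht.1]); linarith
  -- the germs
  set g₁ : ℝ → ℝ := fun t ↦ levLo b₂ κ (-b₁.alphaHi κ t) with hg₁
  set g₂ : ℝ → ℝ := fun t ↦ levHi b₂ κ (-b₁.alphaLo κ (t - 1)) with hg₂
  have hg₁s : ∀ t ∈ Ioo u₀ u₇, ContDiffAt ℝ ∞ g₁ t ∧ 0 < deriv g₁ t := by
    intro t ht
    have hl := levHiZone ht
    obtain ⟨hs, hd⟩ := contDiffAt_levLo hκ b₂ h7₂ (v := -b₁.alphaHi κ t) ⟨by linarith [hl.1], by linarith [hl.2]⟩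
    have hin : HasDerivAt (fun t ↦ -b₁.alphaHi κ t) (-(deriv b₁.chiHi t / κ)) t := (b₁.hasDerivAt_alphaHi κ t).neg
    have hcomp : HasDerivAt g₁ (deriv (levLo b₂ κ) (-b₁.alphaHi κ t) * -(deriv b₁.chiHi t / κ)) t :=
      HasDerivAt.comp (h₂ := levLo b₂ κ) (h := fun t ↦ -b₁.alphaHi κ t) t ((hs.differentiableAt (by simp)).hasDerivAt) hin
    refine ⟨hs.comp t ((b₁.contDiff_alphaHi κ).neg.contDiffAt), ?_⟩
    rw [hcomp.deriv]
    have hneg : deriv b₁.chiHi t / κ < 0 := div_neg_of_neg_of_pos (b₁.deriv_chiHi_neg (hcoreHi (Ioo_subset_Icc_self ht))) hκ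
    nlinarith
  have hg₂s : ∀ t ∈ Ioo w₇ w₀, ContDiffAt ℝ ∞ g₂ t ∧ 0 < deriv g₂ t := by
    intro t ht
    have hl := levLoZone ht
    obtain ⟨hs, hd⟩ := contDiffAt_levHi hκ b₂ h7₂' (v := -b₁.alphaLo κ (t - 1)) ⟨by linarith [hl.1], by linarith [hl.2]⟩
    have hsub : HasDerivAt (fun t : ℝ ↦ t - 1) 1 t := (hasDerivAt_id t).sub_const 1
    have hsh : HasDerivAt (fun t ↦ b₁.alphaLo κ (t - 1)) (deriv b₁.chiLo (t - 1) / κ * 1) t :=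
      HasDerivAt.comp (h₂ := b₁.alphaLo κ) (h := fun t : ℝ ↦ t - 1) t (b₁.hasDerivAt_alphaLo κ (t - 1)) hsub
    have hin : HasDerivAt (fun t ↦ -b₁.alphaLo κ (t - 1)) (-(deriv b₁.chiLo (t - 1) / κ * 1)) t := hsh.neg
    have hcomp : HasDerivAt g₂ (deriv (levHi b₂ κ) (-b₁.alphaLo κ (t - 1)) * -(deriv b₁.chiLo (t - 1) / κ * 1)) t :=
      HasDerivAt.comp (h₂ := levHi b₂ κ) (h := fun t ↦ -b₁.alphaLo κ (t - 1)) t ((hs.differentiableAt (by simp)).hasDerivAt) hin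
    refine ⟨hs.comp t (((b₁.contDiff_alphaLo κ).comp (contDiff_id.sub contDiff_const)).neg.contDiffAt), ?_⟩
    rw [hcomp.deriv]
    have hpos : 0 < deriv b₁.chiLo (t - 1) / κ := div_pos (b₁.deriv_chiLo_pos (hcoreLo (Ioo_subset_Icc_self ht))) hκ
    nlinarith
  -- globalise the germs
  obtain ⟨G₁, hG₁s, hG₁eq, hG₁d, -, -, -⟩ := exists_increasing_extension_left o01 (lt_trans o15 o56) o67
    (fun t ht ↦ (hg₁s t ht).1) (fun t ht ↦ (hg₁s t ht).2)
  obtain ⟨G₂, hG₂s, hG₂eq, hG₂d, -, -, -⟩ := exists_increasing_extension_right ow76 (lt_trans ow65 ow51) ow10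
    (fun t ht ↦ (hg₂s t ht).1) (fun t ht ↦ (hg₂s t ht).2)
  -- values of the germs at levels in `[-7, 7]`
  have g₁val : ∀ {t}, t ∈ Icc u₁ u₆ → g₁ t ∈ Icc (b₂.tcLo - b₂.epsLo / 8) (b₂.tcLo + b₂.epsLo / 8) ∧ b₂.alphaLo κ (g₁ t) = -b₁.alphaHi κ t :=
    fun {t} ht ↦ by
    have hl := levHiZone ⟨lt_of_lt_of_le o01 ht.1, lt_of_le_of_lt ht.2 o67⟩
    have hv : -b₁.alphaHi κ t ∈ Icc (-7 : ℝ) 7 := ⟨by linarith [hl.1], by linarith [hl.2]⟩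
    have e : g₁ t = b₂.parLo hκ h7₂ hv := levLo_eq_parLo hκ b₂ h7₂ hv
    rw [e]; exact ⟨b₂.parLo_mem_core hκ h7₂ hv, b₂.alphaLo_parLo hκ h7₂ hv⟩
  have g₂val : ∀ {t}, t ∈ Icc w₆ w₁ → g₂ t ∈ Icc (b₂.tcHi - b₂.epsHi / 8) (b₂.tcHi + b₂.epsHi / 8) ∧ b₂.alphaHi κ (g₂ t) = -b₁.alphaLo κ (t - 1) :=
    fun {t} ht ↦ by
    have hl := levLoZone ⟨lt_of_lt_of_le ow76 ht.1, lt_of_le_of_lt ht.2 ow10⟩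
    have hv : -b₁.alphaLo κ (t - 1) ∈ Icc (-7 : ℝ) 7 := ⟨by linarith [hl.1], by linarith [hl.2]⟩
    have e : g₂ t = b₂.parHi hκ h7₂' hv := levHi_eq_parHi hκ b₂ h7₂' hv
    rw [e]; exact ⟨b₂.parHi_mem_core hκ h7₂' hv, b₂.alphaHi_parHi hκ h7₂' hv⟩
  -- end values of the blend zones
  have hv6 : (21 / 4 : ℝ) ∈ Icc (-7 : ℝ) 7 := ⟨by norm_num, by norm_num⟩
  have e₁ : G₁ u₆ = b₂.parLo hκ h7₂ hv6 := by
    rw [hG₁eq u₆ ⟨(lt_trans o15 o56).le, le_rfl⟩]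
    have hu₆c : u₆ ∈ Icc (b₁.tcHi - b₁.epsHi / 8) (b₁.tcHi + b₁.epsHi / 8) := b₁.parHi_mem_core hκ h7₁' neg_twentyone_mem
    have ha : -b₁.alphaHi κ u₆ = 21 / 4 := by rw [hu₆, b₁.alphaHi_parHi hκ h7₁' neg_twentyone_mem]; norm_num
    simp only [hg₁, ha]; exact levLo_eq_parLo hκ b₂ h7₂ hv6
  have e₂ : G₂ w₆ = b₂.parHi hκ h7₂' hv6 := by
    rw [hG₂eq w₆ ⟨le_rfl, (lt_trans ow65 ow51).le⟩]
    have ha : -b₁.alphaLo κ (w₆ - 1) = 21 / 4 := by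
      rw [hw₆, add_sub_cancel_right, b₁.alphaLo_parLo hκ h7₁ neg_twentyone_mem]; norm_num
    simp only [hg₂, ha]; exact levHi_eq_parHi hκ b₂ h7₂' hv6
  have hlt12 : b₂.parLo hκ h7₂ hv6 < b₂.parHi hκ h7₂' hv6 := b₂.parLo_lt_parHi hκ h7₂ h7₂' hv6 hv6
  -- the affine middle piece through `(u₅, G₁ u₆)` and `(w₅, G₂ w₆)`
  have huw : u₅ < w₅ := by linarith
  set N : ℝ := (b₂.parHi hκ h7₂' hv6 - b₂.parLo hκ h7₂ hv6) / (w₅ - u₅) with hN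
  have hN0 : 0 < N := div_pos (by linarith) (by linarith)
  set ℓ : ℝ → ℝ := fun t ↦ b₂.parLo hκ h7₂ hv6 + N * (t - u₅) with hℓ
  have hℓs : ContDiff ℝ ∞ ℓ := contDiff_const.add (contDiff_const.mul (contDiff_id.sub contDiff_const))
  have hℓD : ∀ t, HasDerivAt ℓ N t := fun t ↦ by
    have h := (((hasDerivAt_id t).sub_const u₅).const_mul N).const_add (b₂.parLo hκ h7₂ hv6)
    rw [mul_one] at h; exact h
  have hℓd : ∀ t, deriv ℓ t = N := fun t ↦ (hℓD t).deriv
  have eN : N * (w₅ - u₅) = b₂.parHi hκ h7₂' hv6 - b₂.parLo hκ h7₂ hv6 := by rw [hN]; exact div_mul_cancel₀ _ (by linarith)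
  have vℓ₁ : ℓ u₅ = b₂.parLo hκ h7₂ hv6 := by simp [hℓ]
  have vℓ₂ : ℓ w₅ = b₂.parHi hκ h7₂' hv6 := by
    show b₂.parLo hκ h7₂ hv6 + N * (w₅ - u₅) = _; rw [eN]; ring
  -- monotonicity of `G₁` on `[u₅, u₆]`, of `G₂` on `[w₆, w₅]`
  have hG₁mono : MonotoneOn G₁ (Icc u₅ u₆) :=
    (strictMonoOn_of_deriv_pos (convex_Icc _ _) hG₁s.continuous.continuousOn fun t ht ↦
      hG₁d t (by rw [interior_Icc] at ht; exact ht.2.le)).monotoneOn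
  have hG₂mono : MonotoneOn G₂ (Icc w₆ w₅) :=
    (strictMonoOn_of_deriv_pos (convex_Icc _ _) hG₂s.continuous.continuousOn fun t ht ↦
      hG₂d t (by rw [interior_Icc] at ht; exact ht.1.le)).monotoneOn
  -- first blend on `[u₅, u₆]`
  have hℓmono : ∀ s t, s ≤ t → ℓ s ≤ ℓ t := fun s t hst ↦ by
    show b₂.parLo hκ h7₂ hv6 + N * (s - u₅) ≤ b₂.parLo hκ h7₂ hv6 + N * (t - u₅)
    have := mul_le_mul_of_nonneg_left (sub_le_sub_right hst u₅) hN0.le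
    linarith
  have hle₁ : ∀ t ∈ Icc u₅ u₆, G₁ t ≤ ℓ t := fun t ht ↦ by
    have h1 : G₁ t ≤ G₁ u₆ := hG₁mono ht ⟨o56.le, le_rfl⟩ ht.2
    have h2 : ℓ u₅ ≤ ℓ t := hℓmono _ _ ht.1
    rw [e₁] at h1; rw [vℓ₁] at h2; linarith
  obtain ⟨H₁, hH₁s, hH₁l, hH₁r, hH₁d, -⟩ := exists_blend_deriv_pos o56 hG₁s hℓs hle₁
    (fun t ht ↦ hG₁d t ht.2) (fun t _ ↦ by rw [hℓd t]; exact hN0)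
  -- second blend on `[w₆, w₅]`
  have hle₂ : ∀ t ∈ Icc w₆ w₅, H₁ t ≤ G₂ t := fun t ht ↦ by
    rw [hH₁r t (by linarith [ht.1])]
    have h1 : ℓ t ≤ ℓ w₅ := hℓmono _ _ ht.2
    have h2 : G₂ w₆ ≤ G₂ t := hG₂mono ⟨le_rfl, ow65.le⟩ ht ht.1
    rw [e₂] at h2; rw [vℓ₂] at h1; linarith
  have hd₂ : ∀ t ∈ Icc w₆ w₅, 0 < deriv H₁ t := fun t ht ↦ by
    have hev : H₁ =ᶠ[𝓝 t] ℓ := by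
      filter_upwards [Ioi_mem_nhds (show u₆ < t by linarith [ht.1])] with s hs using hH₁r s hs.le
    rw [hev.deriv_eq, hℓd]; exact hN0
  obtain ⟨H₂, hH₂s, hH₂l, hH₂r, hH₂d, -⟩ := exists_blend_deriv_pos ow65 hH₁s hG₂s hle₂ hd₂ (fun t ht ↦ hG₂d t ht.1)
  -- conclusions
  refine ⟨H₂, hH₂s, fun t ht ↦ ?_, fun t ht ↦ ?_, fun t ht ↦ ?_⟩
  · rw [hH₂l t (by linarith [ht.2]), hH₁l t ht.2, hG₁eq t ⟨ht.1, by linarith [ht.2]⟩]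
    exact g₁val ⟨ht.1, by linarith [ht.2]⟩
  · rw [hH₂r t ht.1, hG₂eq t ⟨by linarith [ht.1], ht.2⟩]
    exact g₂val ⟨by linarith [ht.1], ht.2⟩
  · rcases le_or_gt t u₆ with h1 | h1
    · have hev : H₂ =ᶠ[𝓝 t] H₁ := by
        filter_upwards [Iio_mem_nhds (show t < w₆ by linarith)] with s hs using hH₂l s hs.le
      rw [hev.deriv_eq]
      rcases lt_or_ge t u₅ with h2 | h2
      · have hev' : H₁ =ᶠ[𝓝 t] G₁ := by
          filter_upwards [Iio_mem_nhds h2] with s hs using hH₁l s hs.le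
        rw [hev'.deriv_eq]; exact hG₁d t h1
      · exact hH₁d t ⟨h2, h1⟩
    rcases lt_or_ge t w₆ with h2 | h2
    · have hev : H₂ =ᶠ[𝓝 t] ℓ := by
        filter_upwards [Iio_mem_nhds h2, Ioi_mem_nhds h1] with s hs hs'
        rw [hH₂l s hs.le, hH₁r s hs'.le]
      rw [hev.deriv_eq, hℓd]; exact hN0
    rcases le_or_gt t w₅ with h3 | h3
    · exact hH₂d t ⟨h2, h3⟩
    · have hev : H₂ =ᶠ[𝓝 t] G₂ := by
        filter_upwards [Ioi_mem_nhds h3] with s hs using hH₂r s hs.le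
      rw [hev.deriv_eq]; exact hG₂d t (by linarith)

/-- **The junction clock** (chosen). [folklore] -/
def junctionClock : ℝ → ℝ := (exists_junctionClock b₁ b₂ hκ h7₁ h7₁' h7₂ h7₂').choose

/-- The junction clock is `C^∞`. [folklore] -/
theorem contDiff_junctionClock : ContDiff ℝ ∞ (junctionClock b₁ b₂ hκ h7₁ h7₁' h7₂ h7₂') :=
  (exists_junctionClock b₁ b₂ hκ h7₁ h7₁' h7₂ h7₂').choose_spec.1

/-- **On the first junction zone the clocks are matched**: `ϑ t` is in the lower core of `b₂` with
`αLo₂ (ϑ t) = -αHi₁ t`, for `t ∈ [parHi₁ (-1/2), parHi₁ (-5)]`. [folklore] -/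
theorem junctionClock_lo {t : ℝ} (ht : t ∈ Icc (b₁.parHi hκ h7₁' neg_half_mem) (b₁.parHi hκ h7₁' neg_five_mem)) :
    junctionClock b₁ b₂ hκ h7₁ h7₁' h7₂ h7₂' t ∈ Icc (b₂.tcLo - b₂.epsLo / 8) (b₂.tcLo + b₂.epsLo / 8) ∧
      b₂.alphaLo κ (junctionClock b₁ b₂ hκ h7₁ h7₁' h7₂ h7₂' t) = -b₁.alphaHi κ t :=
  (exists_junctionClock b₁ b₂ hκ h7₁ h7₁' h7₂ h7₂').choose_spec.2.1 t ht

/-- **On the second junction zone the clocks are matched**: `ϑ t` is in the upper core of `b₂` with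
`αHi₂ (ϑ t) = -αLo₁ (t - 1)`, for `t ∈ [parLo₁ (-5) + 1, parLo₁ (-1/2) + 1]`. [folklore] -/
theorem junctionClock_hi {t : ℝ} (ht : t ∈ Icc (b₁.parLo hκ h7₁ neg_five_mem + 1) (b₁.parLo hκ h7₁ neg_half_mem + 1)) :
    junctionClock b₁ b₂ hκ h7₁ h7₁' h7₂ h7₂' t ∈ Icc (b₂.tcHi - b₂.epsHi / 8) (b₂.tcHi + b₂.epsHi / 8) ∧
      b₂.alphaHi κ (junctionClock b₁ b₂ hκ h7₁ h7₁' h7₂ h7₂' t) = -b₁.alphaLo κ (t - 1) :=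
  (exists_junctionClock b₁ b₂ hκ h7₁ h7₁' h7₂ h7₂').choose_spec.2.2.1 t ht

/-- The junction clock has positive derivative on the whole foreign zone. [folklore] -/
theorem deriv_junctionClock_pos {t : ℝ} (ht : t ∈ Icc (b₁.parHi hκ h7₁' neg_half_mem) (b₁.parLo hκ h7₁ neg_half_mem + 1)) :
    0 < deriv (junctionClock b₁ b₂ hκ h7₁ h7₁' h7₂ h7₂') t :=
  (exists_junctionClock b₁ b₂ hκ h7₁ h7₁' h7₂ h7₂').choose_spec.2.2.2 t ht

/-- **The junction clock is strictly increasing on the foreign zone.** [folklore] -/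
theorem strictMonoOn_junctionClock :
    StrictMonoOn (junctionClock b₁ b₂ hκ h7₁ h7₁' h7₂ h7₂') (Icc (b₁.parHi hκ h7₁' neg_half_mem) (b₁.parLo hκ h7₁ neg_half_mem + 1)) :=
  strictMonoOn_of_deriv_pos (convex_Icc _ _) (contDiff_junctionClock b₁ b₂ hκ h7₁ h7₁' h7₂ h7₂').continuous.continuousOn fun _ ht ↦
    deriv_junctionClock_pos b₁ b₂ hκ h7₁ h7₁' h7₂ h7₂' (interior_subset ht)

/-- **The junction clock at a matched level is the lower-core parameter of `b₂`.** [folklore] -/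
theorem junctionClock_eq_parLo {t : ℝ} (ht : t ∈ Icc (b₁.parHi hκ h7₁' neg_half_mem) (b₁.parHi hκ h7₁' neg_five_mem))
    {v : ℝ} (hv : v ∈ Icc (-7 : ℝ) 7) (hlev : b₁.alphaHi κ t = -v) :
    junctionClock b₁ b₂ hκ h7₁ h7₁' h7₂ h7₂' t = b₂.parLo hκ h7₂ hv := by
  obtain ⟨hc, ha⟩ := junctionClock_lo b₁ b₂ hκ h7₁ h7₁' h7₂ h7₂' ht
  refine (b₂.strictMonoOn_alphaLo (κ := κ) hκ).injOn hc (b₂.parLo_mem_core hκ h7₂ hv) ?_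
  rw [ha, hlev, neg_neg, b₂.alphaLo_parLo hκ h7₂ hv]

/-- **The junction clock at a matched level is the upper-core parameter of `b₂`.** [folklore] -/
theorem junctionClock_eq_parHi {t : ℝ} (ht : t ∈ Icc (b₁.parLo hκ h7₁ neg_five_mem + 1) (b₁.parLo hκ h7₁ neg_half_mem + 1))
    {v : ℝ} (hv : v ∈ Icc (-7 : ℝ) 7) (hlev : b₁.alphaLo κ (t - 1) = -v) :
    junctionClock b₁ b₂ hκ h7₁ h7₁' h7₂ h7₂' t = b₂.parHi hκ h7₂' hv := by
  obtain ⟨hc, ha⟩ := junctionClock_hi b₁ b₂ hκ h7₁ h7₁' h7₂ h7₂' ht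
  refine (b₂.strictAntiOn_alphaHi (κ := κ) hκ).injOn hc (b₂.parHi_mem_core hκ h7₂' hv) ?_
  rw [ha, hlev, neg_neg, b₂.alphaHi_parHi hκ h7₂' hv]

/-- The junction clock at the two ends of the foreign zone. [folklore] -/
theorem junctionClock_ends :
    junctionClock b₁ b₂ hκ h7₁ h7₁' h7₂ h7₂' (b₁.parHi hκ h7₁' neg_half_mem) = b₂.parLo hκ h7₂ half_mem ∧
      junctionClock b₁ b₂ hκ h7₁ h7₁' h7₂ h7₂' (b₁.parLo hκ h7₁ neg_half_mem + 1) = b₂.parHi hκ h7₂' half_mem := by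
  have o15 := b₁.parHi_lt_parHi hκ h7₁' neg_five_mem neg_half_mem (by norm_num)
  have o15' := b₁.parLo_lt_parLo hκ h7₁ neg_five_mem neg_half_mem (by norm_num)
  constructor
  · refine junctionClock_eq_parLo b₁ b₂ hκ h7₁ h7₁' h7₂ h7₂' ⟨le_rfl, o15.le⟩ half_mem ?_
    rw [b₁.alphaHi_parHi hκ h7₁' neg_half_mem]
  · refine junctionClock_eq_parHi b₁ b₂ hκ h7₁ h7₁' h7₂ h7₂' ⟨by linarith, le_rfl⟩ half_mem ?_
    rw [add_sub_cancel_right, b₁.alphaLo_parLo hκ h7₁ neg_half_mem]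

/-- **The junction clock maps the foreign zone into `[parLo₂ (1/2), parHi₂ (1/2)]`.** [folklore] -/
theorem junctionClock_mem {t : ℝ} (ht : t ∈ Icc (b₁.parHi hκ h7₁' neg_half_mem) (b₁.parLo hκ h7₁ neg_half_mem + 1)) :
    junctionClock b₁ b₂ hκ h7₁ h7₁' h7₂ h7₂' t ∈ Icc (b₂.parLo hκ h7₂ half_mem) (b₂.parHi hκ h7₂' half_mem) := by
  obtain ⟨e1, e2⟩ := junctionClock_ends b₁ b₂ hκ h7₁ h7₁' h7₂ h7₂'
  have hm := (strictMonoOn_junctionClock b₁ b₂ hκ h7₁ h7₁' h7₂ h7₂').monotoneOn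
  have hlt : b₁.parHi hκ h7₁' neg_half_mem ≤ b₁.parLo hκ h7₁ neg_half_mem + 1 := by
    have h1 := (b₁.parHi_mem_core hκ h7₁' neg_half_mem).2
    have h2 := (b₁.parLo_mem_core hκ h7₁ neg_half_mem).1
    have := b₁.core_marks; linarith
  constructor
  · rw [← e1]; exact hm ⟨le_rfl, hlt⟩ ht ht.1
  · rw [← e2]; exact hm ht ⟨hlt, le_rfl⟩ ht.2

end Junction

end BandData

end Literature.Topology.FourManifolds
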